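import Summits.MatrixMultiplication.OmegaCensus.SmallFormats.GF2OrbitSweep
import HarnessLib

/-!
# ω-census family (a) / cell pub-mm22, v4 (0′)/(0″) glue: PROFILE ⇒ ROWS, and «no valid N-profile ⇒ Cert [] (N+1)»

Cell `pub-mm22` (MatrixMultiplication venture; HOME `run/shared/lean/pub/pub-mm22/`; seat LIT-2 g9), topic
`Summits/Ventures/MM22` (the `⟨3,3,3⟩ / 𝔽₂` root programme; generic in the format `⟨l,m,n⟩`).
HONEST FRAMING: checker PLUMBING, not a result and not a bound.  It is the once-and-for-all reduction
(REF-ROOT-TODAY §R(i); p2 KERNEL-ROUTE.md §1(b)) from bilinear computations to «profiles» that the cell's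
whole-root certificates (p2 PROFILE-CERT, engine-2 M2-SPLIT / ProfileSAT, p1 ProfileCertKernel pilot) are
stated over:

* `profileOf β i` — the bit pattern (`bitsOfForm`) of the first form `f_i` of a computation
  `β : BilinComp (mulBilin (ZMod 2) l m n) ι` of `(X, Y) ↦ XY` on the full matrix space;
* `row_le (h : Cert l m n M b) : b + #{i : profileOf β i ∈ M} ≤ |ι|` — ONE ROW: the products whose
  first form is (the form of) a listed constraint pattern of `M` vanish on `S_M = subOf l m M`, the
  others compute `XY|_{S_M}` (Wang 2026, Lemma 3 = tree `BilinComp.restrictAlong`), and `S_M` needs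
  `≥ b` products (`Cert`).  No span-closure of `M` is needed for the inequality (a span-closed member
  list only makes it sharper);
* `RowsOK N rows prof := ∀ (M, b) ∈ rows, b + #{i : prof i ∈ M} ≤ N` and `rowsOK_profileOf`;
* `cert_succ_of_noProfile` — if `Cert l m n [] N` (every computation has `≥ N` products), every cited
  row is a `Cert` fact, and NO function `prof : Fin N → ℕ` with `0 < prof i < 2^(l m)` satisfies
  `RowsOK N rows prof`, then `Cert l m n [] (N + 1)`.  (A computation of length exactly `N` has all
  first forms nonzero — otherwise dropping a zero form contradicts `Cert [] N` — and its profile is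
  valid; lengths `< N` are excluded by `Cert [] N` itself.)

Consumers supply `¬ ∃ prof, …` from their own checker (LP-dual / SAT-LRAT / DFS) and the row list with
its `Cert` citations (Wang's table via the D3-STRETCH chain + the lifted orbits as hypotheses); the
conclusion `Cert 3 3 3 [] 21` turns into `RankGe21F2` by `le_tensorRank_matMulTensor_of_forall_constrained`
exactly as in `WangTop333Cert` / `Root21Of480`.  Vocabulary sheet: HOME `lit/LIT2-ROWMODEL-DECLS.md`.
-/

namespace Summit.Ventures.MM22.GF2Cert.Profile

open Summit.MatrixMultiplication.OmegaCensus.GF2RankLB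
open Literature.Computability.AlgebraicComplexity
open Module Matrix

variable {l m n : ℕ} {ι : Type*} [Fintype ι]

/-! ## Computations on the full space vs. on `subOf l m []` -/

/-- Every matrix lies in the unconstrained subspace `subOf l m []`. -/
theorem mem_subOf_nil (x : Matrix (Fin l) (Fin m) (ZMod 2)) : x ∈ subOf l m [] :=
  mem_constrSub.2 (by simp)

/-- The inclusion of the full matrix space into `subOf l m []` (a linear equivalence in disguise). -/
def toNil (l m : ℕ) : Matrix (Fin l) (Fin m) (ZMod 2) →ₗ[ZMod 2] subOf l m [] :=
  LinearMap.codRestrict (subOf l m []) LinearMap.id (fun x => mem_subOf_nil x)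

/-- A computation of `XY|_{subOf [] × 𝔽₂^{m×n}}` is a computation of `XY` on the full space (same
index set): `f̂_i = f_i ∘ toNil`. -/
def ofNil (β : BilinComp (psiK l m n []) ι) : BilinComp (mulBilin (ZMod 2) l m n) ι :=
  β.comap (toNil l m) LinearMap.id LinearMap.id (fun x y => by
    simp [toNil, LinearMap.codRestrict, mulBilin_apply])

/-- The first forms of `ofNil β`. -/
@[simp] theorem ofNil_f (β : BilinComp (psiK l m n []) ι) (i : ι) (x : Matrix (Fin l) (Fin m) (ZMod 2)) :
    (ofNil β).f i x = β.f i (toNil l m x) := rfl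

/-- `f̂_i = 0 ↔ f_i = 0`. -/
theorem ofNil_f_eq_zero_iff (β : BilinComp (psiK l m n []) ι) (i : ι) :
    (ofNil β).f i = 0 ↔ β.f i = 0 := by
  constructor
  · intro h
    apply LinearMap.ext
    intro u
    have hu : toNil l m (u : Matrix (Fin l) (Fin m) (ZMod 2)) = u := by
      apply Subtype.ext; simp [toNil]
    have := LinearMap.congr_fun h (u : Matrix (Fin l) (Fin m) (ZMod 2))
    rw [ofNil_f, hu] at this
    simpa using this
  · intro h
    apply LinearMap.ext
    intro x
    rw [ofNil_f, h]
    rfl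

/-! ## Profiles and rows -/

/-- The **profile** of a computation on the full space: the bit patterns of its first forms
(`form l m (profileOf β i) = f_i`, `form_bitsOfForm`). -/
noncomputable def profileOf (β : BilinComp (mulBilin (ZMod 2) l m n) ι) (i : ι) : ℕ := bitsOfForm (β.f i)

/-- `form (profileOf β i) = f_i`. -/
theorem form_profileOf (β : BilinComp (mulBilin (ZMod 2) l m n) ι) (i : ι) :
    form l m (profileOf β i) = β.f i := form_bitsOfForm _

/-- Profiles are bit patterns `< 2^(l m)`. -/
theorem profileOf_lt (β : BilinComp (mulBilin (ZMod 2) l m n) ι) (i : ι) : profileOf β i < 2 ^ (l * m) :=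
  bitsOfForm_lt _

/-- A nonzero first form has a nonzero pattern. -/
theorem profileOf_ne_zero (β : BilinComp (mulBilin (ZMod 2) l m n) ι) (i : ι) (h : β.f i ≠ 0) :
    profileOf β i ≠ 0 := by
  intro h0
  apply h
  rw [← form_profileOf β i, h0]
  exact form_zero l m

/-- A listed constraint pattern vanishes (as a form) on the constraint subspace. -/
theorem form_apply_eq_zero_of_mem {M : List ℕ} {κ : ℕ} (hκ : κ ∈ M) (u : subOf l m M) :
    form l m κ (u : Matrix (Fin l) (Fin m) (ZMod 2)) = 0 :=
  (mem_constrSub.1 u.2) (form l m κ) (List.mem_map.2 ⟨κ, hκ, rfl⟩)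

/-- **ONE ROW** (REF-ROOT-TODAY §R(i); Wang 2026 Lemma 3): if `S_M = subOf l m M` needs `≥ b` products
(`Cert l m n M b`), then in every computation of `⟨l,m,n⟩` the products whose first-form pattern is
listed in `M` number at most `|ι| − b`. -/
theorem row_le [DecidableEq ι] (β : BilinComp (mulBilin (ZMod 2) l m n) ι) {M : List ℕ} {b : ℕ}
    (h : Cert l m n M b) :
    b + (Finset.univ.filter fun i => profileOf β i ∈ M).card ≤ Fintype.card ι := by
  classical
  set J : Finset ι := Finset.univ.filter fun i => profileOf β i ∈ M with hJdef
  have hJ : ∀ i ∈ J, ∀ u : subOf l m M,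
      (β.restrictSub (subOf l m M)).f i (Submodule.inclusion le_rfl u) = 0 := by
    intro i hi u
    have hmem : profileOf β i ∈ M := (Finset.mem_filter.1 hi).2
    simp only [BilinComp.restrictSub, BilinComp.comap_f, Submodule.subtype_apply,
      Submodule.coe_inclusion]
    rw [← form_profileOf β i]
    exact form_apply_eq_zero_of_mem hmem u
  obtain ⟨γ⟩ := BilinComp.exists_restrictAlong (β.restrictSub (subOf l m M)) le_rfl J hJ
  have hb := h _ γ
  have hJle : J.card ≤ Fintype.card ι := Finset.card_le_univ J
  omega

/-- **Validity of a profile against a row list**: `rows` = list of `(M, b)` (constraint patterns of a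
cited `Cert l m n M b`); `prof` is valid when every row inequality `b + #{i : prof i ∈ M} ≤ N` holds. -/
def RowsOK (N : ℕ) (rows : List (List ℕ × ℕ)) (prof : Fin N → ℕ) : Prop :=
  ∀ r ∈ rows, r.2 + (Finset.univ.filter fun i => prof i ∈ r.1).card ≤ N

/-- The profile of a length-`N` computation is valid against every list of certified rows. -/
theorem rowsOK_profileOf {N : ℕ} (rows : List (List ℕ × ℕ)) (hrows : ∀ r ∈ rows, Cert l m n r.1 r.2)
    (β : BilinComp (mulBilin (ZMod 2) l m n) (Fin N)) : RowsOK N rows (profileOf β) := by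
  intro r hr
  have h := row_le β (hrows r hr)
  rwa [Fintype.card_fin] at h

/-! ## The assembly -/

/-- **«No valid `N`-profile ⇒ `N + 1`»**: if every computation of `⟨l,m,n⟩|_{subOf []}` over `𝔽₂` has
`≥ N` products, every cited row is certified, and no profile of `N` NONZERO patterns `< 2^(l m)` is
valid against the rows, then every computation has `≥ N + 1` products. -/
theorem cert_succ_of_noProfile {N : ℕ} (hN : Cert l m n [] N) (rows : List (List ℕ × ℕ))
    (hrows : ∀ r ∈ rows, Cert l m n r.1 r.2)
    (hno : ∀ prof : Fin N → ℕ, (∀ i, prof i ≠ 0) → (∀ i, prof i < 2 ^ (l * m)) →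
      RowsOK N rows prof → False) :
    Cert l m n [] (N + 1) := by
  classical
  intro r β
  have hNr : N ≤ r := hN r β
  by_contra hlt
  have hrN : r = N := by omega
  subst hrN
  -- all first forms are nonzero, else dropping one contradicts `Cert [] r`
  have hnz : ∀ i, β.f i ≠ 0 := by
    intro i hi
    have hJ : ∀ j ∈ ({i} : Finset (Fin r)), ∀ u : subOf l m [],
        β.f j (Submodule.inclusion le_rfl u) = 0 := by
      intro j hj u
      rw [Finset.mem_singleton.1 hj, hi]
      rfl
    obtain ⟨γ⟩ := BilinComp.exists_restrictAlong β le_rfl {i} hJ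
    have := hN _ γ
    simp only [Fintype.card_fin, Finset.card_singleton] at this
    have hpos : 0 < r := Fin.pos i
    omega
  let β' := ofNil β
  refine hno (profileOf β') (fun i => profileOf_ne_zero β' i ?_) (fun i => profileOf_lt β' i)
    (rowsOK_profileOf rows hrows β')
  rw [Ne, ofNil_f_eq_zero_iff]
  exact hnz i

/-- Reading off the rank: `Cert l m n [] b` is `b ≤ R_𝔽₂(⟨l,m,n⟩)` (Wang 2026, Lemma 1 at the
unconstrained orbit; tree `le_tensorRank_matMulTensor_of_forall_constrained`). -/
theorem le_tensorRank_of_cert_nil {b : ℕ} (h : Cert l m n [] b) :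
    b ≤ tensorRank (matMulTensor (ZMod 2) l m n) :=
  le_tensorRank_matMulTensor_of_forall_constrained (subOf l m []) h

/-- **Indexed form** (for checkers whose unknowns are indexed by a candidate list): if `cands` lists
every nonzero pattern `< 2^(l m)` and no index profile `idx : Fin N → Fin cands.length` makes
`i ↦ cands[idx i]` valid, then no nonzero profile is valid. -/
theorem noProfile_of_noIndexProfile {N : ℕ} (rows : List (List ℕ × ℕ)) (cands : List ℕ)
    (hcands : ∀ κ : ℕ, κ ≠ 0 → κ < 2 ^ (l * m) → κ ∈ cands)
    (hno : ∀ idx : Fin N → Fin cands.length, RowsOK N rows (fun i => cands.get (idx i)) → False)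
    (prof : Fin N → ℕ) (h0 : ∀ i, prof i ≠ 0) (hlt : ∀ i, prof i < 2 ^ (l * m))
    (hok : RowsOK N rows prof) : False := by
  have hmem : ∀ i, prof i ∈ cands := fun i => hcands _ (h0 i) (hlt i)
  choose idx hidx using fun i => List.mem_iff_get.1 (hmem i)
  refine hno idx ?_
  have hfun : (fun i => cands.get (idx i)) = prof := funext fun i => hidx i
  rw [hfun]
  exact hok

/-- The assembly in indexed form: `Cert [] N`, certified rows, a complete candidate list and
«no valid index profile» give `Cert [] (N + 1)`. -/
theorem cert_succ_of_noIndexProfile {N : ℕ} (hN : Cert l m n [] N) (rows : List (List ℕ × ℕ))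
    (hrows : ∀ r ∈ rows, Cert l m n r.1 r.2) (cands : List ℕ)
    (hcands : ∀ κ : ℕ, κ ≠ 0 → κ < 2 ^ (l * m) → κ ∈ cands)
    (hno : ∀ idx : Fin N → Fin cands.length, RowsOK N rows (fun i => cands.get (idx i)) → False) :
    Cert l m n [] (N + 1) :=
  cert_succ_of_noProfile hN rows hrows (noProfile_of_noIndexProfile rows cands hcands hno)

/-- Executable completeness check for a candidate list: every `0 < κ < 2^(l m)` is listed. -/
def candsCompleteB (l m : ℕ) (cands : List ℕ) : Bool :=
  (List.range (2 ^ (l * m))).all fun κ => κ == 0 || cands.contains κ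

/-- Soundness of `candsCompleteB`. -/
theorem cands_complete_of_B {cands : List ℕ} (h : candsCompleteB l m cands = true) :
    ∀ κ : ℕ, κ ≠ 0 → κ < 2 ^ (l * m) → κ ∈ cands := by
  intro κ h0 hlt
  rw [candsCompleteB, List.all_eq_true] at h
  have hκ := h κ (List.mem_range.2 hlt)
  simp only [Bool.or_eq_true, beq_iff_eq, List.contains_iff_mem] at hκ
  rcases hκ with h | h
  · exact absurd h h0
  · exact h

end Summit.Ventures.MM22.GF2Cert.Profile
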